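import Summits.KontsevichZagierPeriods.KontsevichZagierPeriods.Theorems.UnfoldedStokesStokesGenerationStubDiagReparam

/-!
# `StokesGeneration` (stmt-KontsevichZagierPeriods-3586) — line `fibrewise_stokes`, stub `stub_polylogDuplication`

Registered corollary of stub P1 (`stub_diagReparam`, rule (2) for diagonal reparametrisations of the closed cube) of the
line `fibrewise_stokes` of the crux `StokesGeneration` (route UnfoldedStokes; residual S2 `FibStokesDecomposable`,
`Theorems/UnfoldedStokesDefs.lean`): **the polylogarithm duplication relator is fibrewise-Stokes decomposable.** For a
real algebraic `z` with `|z| < 1` and `P = ∏ᵢ xᵢ` on `[0,1]ⁿ`, the integrand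
`2z²/2ⁿ/(1 − z²P) − (z/(1 − zP) − z/(1 + zP))` — whose integral over the cube is the duplication relation
`2^{1−n} Liₙ(z²) − Liₙ(z) − Liₙ(−z) = 0` of Kontsevich–Zagier's calculus — is decomposable.

Proof. It is POINTWISE on the cube the change-of-variables relator `f − (f ∘ Ψ) · J_Ψ` of the squaring map
`Ψ(x) = (xₐ²)ₐ` (`ψ(u) = u²`, `ψ'(u) = 2u`, fixing `0` and `1`, `0 < u² < 1` inside) applied to
`f(x) = (2z²/2ⁿ)/(1 − z²P)`: indeed `∏ xₐ² = P²`, `∏ 2xₐ = 2ⁿP`, so `(f ∘ Ψ) · J_Ψ = 2z²P/(1 − z²P²) = z/(1 − zP) − z/(1 + zP)`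
(all denominators are positive on the cube since `|zP| ≤ |z| < 1`). The integrand `f` is a rational function with the
algebraic coefficient `z`, hence `ℚ`-semialgebraic and continuous on the cube together with its fibre derivatives
`∂ₐf = (2z²/2ⁿ) z² (∏_{i ≠ a} xᵢ)/(1 − z²P)²`; `stub_diagReparam` applies, and `fibStokesDecomposable_congr_off_null`
(empty null set) transfers decomposability along the pointwise identity.

References: M. Kontsevich, D. Zagier, *Periods* (2001), §1.1 (polylogarithms as periods), §1.2 rules (2), (3);
D. Zagier, *The dilogarithm function* (2007), §I.2 (duplication `Li₂(z²) = 2(Li₂(z) + Li₂(−z))`).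
-/

noncomputable section

-- `Summit.KontsevichZagierPeriods.KontsevichZagierPeriods.…` is the tree's mandated layout (single-conjunct summit).
set_option linter.dupNamespace false

namespace Summit.KontsevichZagierPeriods.KontsevichZagierPeriods.Cruxes.StokesGeneration.FibrewiseStokes

open MeasureTheory Set
open Literature.NumberTheory.Transcendental
open Literature.NumberTheory.Transcendental.KZ
open Literature.ModelTheory.ExponentialFields (IsSemialgebraic)

/-- **Registered stub `stub_polylogDuplication`: the polylogarithm duplication relator is fibrewise-Stokes
decomposable.** For real algebraic `z` with `|z| < 1`, the integrand
`2z²/2ⁿ/(1 − z²∏xᵢ) − (z/(1 − z∏xᵢ) − z/(1 + z∏xᵢ))` on `[0,1]ⁿ` (integrating to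
`2^{1−n}Liₙ(z²) − Liₙ(z) − Liₙ(−z)`) is decomposable: it is pointwise the rule-(2) relator of the squaring map
`x ↦ (xₐ²)ₐ` applied to `(2z²/2ⁿ)/(1 − z²∏xᵢ)` (`stub_diagReparam`).
[cite: KontsevichZagier2001, §1.2 rules (2), (3)] -/
theorem stub_polylogDuplication (n : ℕ) (z : ℝ) (hz : IsAlgebraic ℚ z) (hz1 : |z| < 1) :
    FibStokesDecomposable n (fun x => 2 * z ^ 2 / 2 ^ n / (1 - z ^ 2 * ∏ i, x i) -
      (z / (1 - z * ∏ i, x i) - z / (1 + z * ∏ i, x i))) := by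
  set C : Set (Fin n → ℝ) := Set.pi Set.univ (fun _ : Fin n => Set.Icc (0:ℝ) 1) with hC
  have hCsa : IsSemialgebraic ℚ C := by rw [hC, ← cube_eq_pi]; exact isSemialgebraic_cube
  have h1sa : IsSemialgebraic ℚ (Set.pi Set.univ (fun _ : Fin 1 => Set.Icc (0:ℝ) 1)) := by
    rw [← cube_eq_pi]; exact isSemialgebraic_cube
  have hmem : ∀ x ∈ C, ∀ i, x i ∈ Set.Icc (0:ℝ) 1 := fun x hx i => (Set.mem_univ_pi.mp hx) i
  -- products of coordinates lie in `[0,1]` on the cube; the denominator `1 - z² ∏ xᵢ` is positive there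
  have hPI : ∀ x ∈ C, ∀ s : Finset (Fin n), 0 ≤ ∏ i ∈ s, x i ∧ ∏ i ∈ s, x i ≤ 1 := fun x hx s =>
    ⟨Finset.prod_nonneg fun i _ => (hmem x hx i).1,
      Finset.prod_le_one (fun i _ => (hmem x hx i).1) fun i _ => (hmem x hx i).2⟩
  have hden : ∀ x ∈ C, 0 < 1 - z ^ 2 * ∏ i, x i := by
    intro x hx
    have hz2 : z ^ 2 < 1 := (sq_lt_one_iff_abs_lt_one z).mpr hz1
    have := mul_le_of_le_one_right (sq_nonneg z) (hPI x hx Finset.univ).2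
    linarith
  -- the integrand `F` and its fibre derivatives `FD a`
  obtain ⟨F, hF⟩ : ∃ F : (Fin n → ℝ) → ℝ, ∀ x, F x = 2 * z ^ 2 / 2 ^ n / (1 - z ^ 2 * ∏ i, x i) :=
    ⟨_, fun _ => rfl⟩
  obtain ⟨FD, hFD⟩ : ∃ FD : Fin n → (Fin n → ℝ) → ℝ, ∀ a x, FD a x =
      2 * z ^ 2 / 2 ^ n * (z ^ 2 * ∏ i ∈ Finset.univ.erase a, x i) / (1 - z ^ 2 * ∏ i, x i) ^ 2 :=
    ⟨_, fun _ _ => rfl⟩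
  -- semialgebraicity (rational functions with the algebraic coefficient `z`)
  have hc2 : IsSemialgebraicFunOn ℚ C (fun _ => (2:ℝ)) := isSemialgebraicFunOn_const_ofNat hCsa 2
  have hcz : IsSemialgebraicFunOn ℚ C (fun _ => z) := isSemialgebraicFunOn_const_of_isAlgebraic hCsa hz
  have hc1 : IsSemialgebraicFunOn ℚ C (fun _ => (1:ℝ)) := isSemialgebraicFunOn_const_of_isAlgebraic hCsa isAlgebraic_one
  have hPsa : ∀ s : Finset (Fin n), IsSemialgebraicFunOn ℚ C (fun x => ∏ i ∈ s, x i) :=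
    fun s => IsSemialgebraicFunOn.fun_finsetProd s hCsa fun i _ => isSemialgebraicFunOn_apply hCsa i
  have hnum : IsSemialgebraicFunOn ℚ C (fun _ => 2 * z ^ 2 / 2 ^ n) :=
    (hc2.fun_mul (hcz.fun_pow 2)).div (hc2.fun_pow n) fun _ _ => pow_ne_zero n two_ne_zero
  have hdsa : IsSemialgebraicFunOn ℚ C (fun x => 1 - z ^ 2 * ∏ i, x i) :=
    hc1.fun_sub ((hcz.fun_pow 2).fun_mul (hPsa Finset.univ))
  have hFsa : IsSemialgebraicFunOn ℚ C F :=
    (hnum.div hdsa fun x hx => (hden x hx).ne').congr fun x _ => (hF x).symm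
  have hFDsa : ∀ a, IsSemialgebraicFunOn ℚ C (FD a) := fun a =>
    ((hnum.fun_mul ((hcz.fun_pow 2).fun_mul (hPsa _))).div (hdsa.fun_pow 2)
      fun x hx => pow_ne_zero 2 (hden x hx).ne').congr fun x _ => (hFD a x).symm
  -- continuity on the cube
  have hPc : ∀ s : Finset (Fin n), Continuous (fun x : Fin n → ℝ => ∏ i ∈ s, x i) :=
    fun s => continuous_finsetProd s fun i _ => continuous_apply i
  have hdc : Continuous (fun x : Fin n → ℝ => 1 - z ^ 2 * ∏ i, x i) :=
    continuous_const.sub (continuous_const.mul (hPc _))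
  have hFc : ContinuousOn F C :=
    (continuousOn_const.div hdc.continuousOn fun x hx => (hden x hx).ne').congr fun x _ => hF x
  have hFDc : ∀ a, ContinuousOn (FD a) C := fun a =>
    ((continuousOn_const.mul (continuous_const.mul (hPc _)).continuousOn).div (hdc.pow 2).continuousOn
      fun x hx => pow_ne_zero 2 (hden x hx).ne').congr fun x _ => hFD a x
  -- fibre derivatives
  have hFd : ∀ a, ∀ x ∈ C, x a ∈ Set.Ioo (0:ℝ) 1 →
      HasDerivAt (fun s => F (Function.update x a s)) (FD a x) (x a) := by
    intro a x hx _
    obtain ⟨Q, hQ⟩ : ∃ Q : ℝ, ∏ i ∈ Finset.univ.erase a, x i = Q := ⟨_, rfl⟩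
    have hupd : ∀ s, ∏ i, Function.update x a s i = s * Q := by
      intro s
      rw [← Finset.mul_prod_erase Finset.univ (Function.update x a s) (Finset.mem_univ a),
        Function.update_self, ← hQ]
      exact congrArg (s * ·) (Finset.prod_congr rfl fun i hi =>
        Function.update_of_ne (Finset.ne_of_mem_erase hi) _ _)
    have hPQ : ∏ i, x i = x a * Q := by rw [← hupd (x a), Function.update_eq_self]
    have hd0 : 1 - z ^ 2 * (x a * Q) ≠ 0 := by rw [← hPQ]; exact (hden x hx).ne'
    have h1 : HasDerivAt (fun s => 1 - z ^ 2 * (s * Q)) (-(z ^ 2 * Q)) (x a) := by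
      refine ((((hasDerivAt_id' (x a)).mul_const Q).const_mul (z ^ 2)).const_sub 1).congr_deriv ?_
      ring
    have h2 := (hasDerivAt_const (x a) (2 * z ^ 2 / 2 ^ n)).fun_div h1 hd0
    have hfun : (fun s => F (Function.update x a s)) = fun s => 2 * z ^ 2 / 2 ^ n / (1 - z ^ 2 * (s * Q)) := by
      funext s; rw [hF, hupd]
    rw [hfun, hFD, hQ, hPQ]
    exact h2.congr_deriv (by ring)
  -- rule (2) for the squaring map `x ↦ (xₐ²)ₐ`
  have key := stub_diagReparam F FD (fun _ u => u ^ 2) (fun _ u => 2 * u) hFsa hFDsa hFc hFDc hFd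
    (fun _ => (isSemialgebraicFunOn_apply h1sa 0).fun_pow 2)
    (fun _ => (isSemialgebraicFunOn_const_ofNat h1sa 2).fun_mul (isSemialgebraicFunOn_apply h1sa 0))
    (fun _ => (continuous_pow 2).continuousOn) (fun _ => (continuous_const.mul continuous_id).continuousOn)
    (fun _ u _ => by simpa using hasDerivAt_pow 2 u) (fun _ => by norm_num) (fun _ => by norm_num)
    (fun _ u hu => ⟨pow_pos hu.1 2, pow_lt_one₀ hu.1.le hu.2 two_ne_zero⟩)
  -- the pointwise identity on the cube
  refine fibStokesDecomposable_congr_off_null n _ _ ∅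
    Literature.ModelTheory.ExponentialFields.isSemialgebraic_empty measure_empty (fun x hx _ => ?_) key
  have hP := hPI x hx Finset.univ
  have hzP : |z * ∏ i, x i| < 1 := by
    rw [abs_mul, abs_of_nonneg hP.1]
    exact (mul_le_of_le_one_right (abs_nonneg z) hP.2).trans_lt hz1
  obtain ⟨hzP1, hzP2⟩ := abs_lt.mp hzP
  have h3 : (1 - z * ∏ i, x i) ≠ 0 := by linarith
  have h4 : (1 + z * ∏ i, x i) ≠ 0 := by linarith
  have h5 : (1 - z ^ 2 * (∏ i, x i) ^ 2) ≠ 0 := by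
    have hpos := mul_pos (show (0:ℝ) < 1 - z * ∏ i, x i by linarith) (show (0:ℝ) < 1 + z * ∏ i, x i by linarith)
    have e : (1 - z * ∏ i, x i) * (1 + z * ∏ i, x i) = 1 - z ^ 2 * (∏ i, x i) ^ 2 := by ring
    rw [e] at hpos
    exact hpos.ne'
  have h6 : (1 - z ^ 2 * ∏ i, x i) ≠ 0 := (hden x hx).ne'
  have h2n : (2:ℝ) ^ n ≠ 0 := pow_ne_zero n two_ne_zero
  simp only [hF]
  rw [Finset.prod_pow, Finset.prod_mul_distrib, Finset.prod_const, Finset.card_univ, Fintype.card_fin]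
  field_simp
  ring

end Summit.KontsevichZagierPeriods.KontsevichZagierPeriods.Cruxes.StokesGeneration.FibrewiseStokes

end
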